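import Summits.CriticalPhenomena.PercolationContinuityZ3.Theorems.PercNearOneGluingNoHeavyLowerTailFaceIAtom
import Summits.CriticalPhenomena.PercolationContinuityZ3.Theorems.PercNearOneGluingNoHeavyLowerTailFaceRegimeB
import HarnessLib

/-!
# `NoHeavyLowerTail` (stmt-CriticalPhenomena-4575) — the FORMAL FACE of the `2 + (any law)` kernel in the WEAKEST-WITNESS REGIME (I = A′),
# and the resulting `2 + (any law)` kernel

Support file (lemma factory `prim-lf-3` gen 13; `--supports stmt-CriticalPhenomena-4575`).  No definitions, no named facts, no sorries.
Memo: `run/shared/lean/prim/prim-lf-3/LF3-BETA-R.md` §16a (regime table), §17 (T(i) proved from the robust Question 7).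

Setting of `twoPortSide_reduction` / `face_regimeB` / `face_regimeII`: core `K` with `o` isolated, two-port star `{c, d}` (`c` the `K`-weaker port),
arbitrary law `ν ≥ 0` on the subsets of the port set `Q` of the second unit, `u ∈ [0,1]`, forced-star margins `G`, a vertex `q` at most as connected as
`j` and as every port of `Q` in the mixture `K_u = (1−u)K + uK[cd↦1]`.  REGIME I (memo §16a; the lead's regime A′): the witness `j` is at most as
connected as `c` in `K_u` (`hjcu`) and, at every nonempty atom `Y ⊆ Q`, `j` is the least `b`-reliable of `c, d, j` in the mixture
`K_u/Y = (1−u)·glue_Y K + u·glue_Y K[cd↦1]` (hypothesis `hrankI`).  The certificate is `(0, 1−u)`: only the row of `q` is used.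

* `face_regimeI` — THE FORMAL FACE: the split row of `q` (law-summed) implies `0 ≤ Σ_Y ν(Y)[(1−u) G'(Y) + u G(Y ∪ {c,d})]`; atom by atom
  `f_Y ≥ (1−u)·r_{q,Y}` (`faceI_atom` = the spectator-weakest exchange for `Y ≠ ∅`; for `Y = ∅` the glued pair stays above `j` by
  `pairGlue_gain_le` and `hjcu`).
* `twoPlusLaw_regimeI` — with `twoPortSide_reduction`: the `2 + (law ν)` kernel `F ≥ 0` from the split rows of `c`, `d`, `q`, every law `ν`.
With `face_regimeB` (gen 7), `face_regimeC/D` and `face_regimeII` (gen 11) this completes the regime table of the memo: the `2 + (any law)` formal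
face holds whenever the three-way ranking of `c, d, j` is the same at every atom of `Q` (the anchoring proviso of §16e).
-/

namespace Summit.CriticalPhenomena.PercolationContinuityZ3.Theorems

open MeasureTheory Set ProbabilityTheory
open Literature.Probability.LatticeModels
open Literature.Probability.Percolation

noncomputable section
open Classical

namespace UpsetExchange

variable {n : ℕ}

/-- **The formal face in the weakest-witness regime (I = A′).**  See the module docstring. [cite: KozmaNitzan2024, Question 9 (p. 36), Question 7 (p. 36), Lemma 5 (p. 13)] -/
theorem face_regimeI (K : Sym2 (Fin n) → unitInterval) (o c d q j b : Fin n) (Q : Finset (Fin n))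
    (ν : Finset (Fin n) → ℝ) (hν : ∀ S ∈ Q.powerset, 0 ≤ ν S) (u : unitInterval)
    (hoQ : o ∉ Q) (hcQ : c ∉ Q) (hdQ : d ∉ Q) (hbQ : b ∉ Q) (hcd : c ≠ d) (hoc : o ≠ c) (hod : o ≠ d) (hjo : j ≠ o) (hbo : b ≠ o)
    (hisoK : ∀ u' : Fin n, u' ≠ o → K s(o, u') = 0)
    (G : Finset (Fin n) → ℝ)
    (hG : ∀ T : Finset (Fin n), G T =
      (prodBernoulli (fun f : Sym2 (Fin n) => if f ∈ T.image (fun t => s(o, t)) then 1 else K f)).real (openConn o b) -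
        (prodBernoulli (fun f : Sym2 (Fin n) => if f ∈ T.image (fun t => s(o, t)) then 1 else K f)).real (openConn j b))
    (hle : (prodBernoulli K).real (openConn c b) ≤ (prodBernoulli K).real (openConn d b))
    (hcb : c ≠ b) (hdb : d ≠ b) (hjb : j ≠ b) (hcj : c ≠ j) (hdj : d ≠ j) (hjQ : j ∉ Q)
    (hjcu : (1 - (u : ℝ)) * (prodBernoulli K).real (openConn j b) +
        (u : ℝ) * (prodBernoulli (fun f : Sym2 (Fin n) => if f = s(c, d) then 1 else K f)).real (openConn j b) ≤
      (1 - (u : ℝ)) * (prodBernoulli K).real (openConn c b) +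
        (u : ℝ) * (prodBernoulli (fun f : Sym2 (Fin n) => if f = s(c, d) then 1 else K f)).real (openConn c b))
    (hrankI : ∀ Y ∈ Q.powerset, Y ≠ ∅ →
      ((1 - (u : ℝ)) * (prodBernoulli (fun e : Sym2 (Fin n) => if (∀ x ∈ e, x ∈ Y) ∧ ¬ e.IsDiag then 1 else K e)).real (openConn j b) +
          (u : ℝ) * (prodBernoulli (fun f : Sym2 (Fin n) => if f = s(c, d) then 1 else
            (if (∀ x ∈ f, x ∈ Y) ∧ ¬ f.IsDiag then 1 else K f))).real (openConn j b) ≤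
        (1 - (u : ℝ)) * (prodBernoulli (fun e : Sym2 (Fin n) => if (∀ x ∈ e, x ∈ Y) ∧ ¬ e.IsDiag then 1 else K e)).real (openConn c b) +
          (u : ℝ) * (prodBernoulli (fun f : Sym2 (Fin n) => if f = s(c, d) then 1 else
            (if (∀ x ∈ f, x ∈ Y) ∧ ¬ f.IsDiag then 1 else K f))).real (openConn c b)) ∧
      ((1 - (u : ℝ)) * (prodBernoulli (fun e : Sym2 (Fin n) => if (∀ x ∈ e, x ∈ Y) ∧ ¬ e.IsDiag then 1 else K e)).real (openConn j b) +
          (u : ℝ) * (prodBernoulli (fun f : Sym2 (Fin n) => if f = s(c, d) then 1 else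
            (if (∀ x ∈ f, x ∈ Y) ∧ ¬ f.IsDiag then 1 else K f))).real (openConn j b) ≤
        (1 - (u : ℝ)) * (prodBernoulli (fun e : Sym2 (Fin n) => if (∀ x ∈ e, x ∈ Y) ∧ ¬ e.IsDiag then 1 else K e)).real (openConn d b) +
          (u : ℝ) * (prodBernoulli (fun f : Sym2 (Fin n) => if f = s(c, d) then 1 else
            (if (∀ x ∈ f, x ∈ Y) ∧ ¬ f.IsDiag then 1 else K f))).real (openConn d b)))
    (hqj : (1 - (u : ℝ)) * (prodBernoulli K).real (openConn q b) +
        (u : ℝ) * (prodBernoulli (fun f : Sym2 (Fin n) => if f = s(c, d) then 1 else K f)).real (openConn q b) ≤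
      (1 - (u : ℝ)) * (prodBernoulli K).real (openConn j b) +
        (u : ℝ) * (prodBernoulli (fun f : Sym2 (Fin n) => if f = s(c, d) then 1 else K f)).real (openConn j b))
    (hqmin : ∀ y ∈ Q, (1 - (u : ℝ)) * (prodBernoulli K).real (openConn q b) +
        (u : ℝ) * (prodBernoulli (fun f : Sym2 (Fin n) => if f = s(c, d) then 1 else K f)).real (openConn q b) ≤
      (1 - (u : ℝ)) * (prodBernoulli K).real (openConn y b) +
        (u : ℝ) * (prodBernoulli (fun f : Sym2 (Fin n) => if f = s(c, d) then 1 else K f)).real (openConn y b))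
    (hrowq : 0 ≤ ∑ S ∈ Q.powerset, ν S *
      ((1 - (u : ℝ)) * ((prodBernoulli (fun e : Sym2 (Fin n) => if (∀ x ∈ e, x ∈ S) ∧ ¬ e.IsDiag then 1 else K e)).real (openConn q b) -
          (prodBernoulli (fun e : Sym2 (Fin n) => if (∀ x ∈ e, x ∈ S) ∧ ¬ e.IsDiag then 1 else K e)).real (openConn j b)) +
        (u : ℝ) * ((prodBernoulli (fun f : Sym2 (Fin n) => if f = s(c, d) then 1 else
              (if (∀ x ∈ f, x ∈ S) ∧ ¬ f.IsDiag then 1 else K f))).real (openConn q b) -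
          (prodBernoulli (fun f : Sym2 (Fin n) => if f = s(c, d) then 1 else
              (if (∀ x ∈ f, x ∈ S) ∧ ¬ f.IsDiag then 1 else K f))).real (openConn j b)))) :
    0 ≤ ∑ Y ∈ Q.powerset, ν Y * ((1 - (u : ℝ)) * (if Y = ∅ then 0 else G Y) + (u : ℝ) * G (insert c (insert d Y))) := by
  have hu0 : 0 ≤ (u : ℝ) := unitInterval.nonneg u
  have hu1 : 0 ≤ 1 - (u : ℝ) := sub_nonneg.2 (unitInterval.le_one u)
  set e : Sym2 (Fin n) := s(c, d) with he
  -- the atom inequality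
  have key : ∀ Y ∈ Q.powerset,
      (1 - (u : ℝ)) * ((1 - (u : ℝ)) * ((prodBernoulli (fun f : Sym2 (Fin n) => if (∀ x ∈ f, x ∈ Y) ∧ ¬ f.IsDiag then 1 else K f)).real (openConn q b) -
            (prodBernoulli (fun f : Sym2 (Fin n) => if (∀ x ∈ f, x ∈ Y) ∧ ¬ f.IsDiag then 1 else K f)).real (openConn j b)) +
          (u : ℝ) * ((prodBernoulli (fun f : Sym2 (Fin n) => if f = s(c, d) then 1 else
                (if (∀ x ∈ f, x ∈ Y) ∧ ¬ f.IsDiag then 1 else K f))).real (openConn q b) -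
            (prodBernoulli (fun f : Sym2 (Fin n) => if f = s(c, d) then 1 else
                (if (∀ x ∈ f, x ∈ Y) ∧ ¬ f.IsDiag then 1 else K f))).real (openConn j b))) ≤
      (1 - (u : ℝ)) * (if Y = ∅ then 0 else G Y) + (u : ℝ) * G (insert c (insert d Y)) := by
    intro Y hY
    have hYQ : Y ⊆ Q := Finset.mem_powerset.1 hY
    have hcY : c ∉ Y := fun h => hcQ (hYQ h)
    have hdY : d ∉ Y := fun h => hdQ (hYQ h)
    have hbY : b ∉ Y := fun h => hbQ (hYQ h)
    have hoY : o ∉ Y := fun h => hoQ (hYQ h)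
    by_cases hYe : Y = ∅
    · -- the empty atom: the row of `q` at `Y = ∅` (`hqj`) and `α_P ≥ 0`
      subst hYe
      rw [if_pos rfl]
      have hE : (fun f : Sym2 (Fin n) => if (∀ x ∈ f, x ∈ (∅ : Finset (Fin n))) ∧ ¬ f.IsDiag then (1 : unitInterval) else K f) = K := by
        funext f
        rw [if_neg]
        rintro ⟨h1, -⟩
        induction f using Sym2.ind with
        | h x y => exact Finset.notMem_empty x (h1 x (Sym2.mem_mk_left x y))
      have hE' : (fun f : Sym2 (Fin n) => if f = s(c, d) then (1 : unitInterval) else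
          (if (∀ x ∈ f, x ∈ (∅ : Finset (Fin n))) ∧ ¬ f.IsDiag then 1 else K f)) = fun f => if f = s(c, d) then 1 else K f := by
        funext f
        by_cases hf : f = s(c, d)
        · rw [if_pos hf, if_pos hf]
        · rw [if_neg hf, if_neg hf, congrFun hE f]
      rw [hE, hE']
      -- `G {c, d}` through the sure pair `e`
      have hocd : o ∉ ({c, d} : Finset (Fin n)) := by
        simp only [Finset.mem_insert, Finset.mem_singleton, not_or]; exact ⟨hoc, hod⟩
      have hreach : ∀ t ∈ ({c, d} : Finset (Fin n)), t = c ∨ s(c, t) ∈ ({e} : Finset (Sym2 (Fin n))) ∨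
          ∃ m : Fin n, m ≠ c ∧ m ≠ t ∧ s(m, c) ∈ ({e} : Finset (Sym2 (Fin n))) ∧ s(m, t) ∈ ({e} : Finset (Sym2 (Fin n))) := by
        intro t ht
        simp only [Finset.mem_insert, Finset.mem_singleton] at ht
        rcases ht with rfl | rfl
        · exact Or.inl rfl
        · exact Or.inr (Or.inl (Finset.mem_singleton_self _))
      have hSin : ∀ f ∈ ({e} : Finset (Sym2 (Fin n))), ∀ x ∈ f, x ∈ ({c, d} : Finset (Fin n)) := by
        intro f hf x hx
        rw [Finset.mem_singleton] at hf; subst hf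
        rcases Sym2.mem_iff.1 hx with rfl | rfl <;> simp
      have hGcd := forcedMargin_eq K o b j hisoK hbo hjo {c, d} hocd c (by simp) {e} hSin hreach
      have hfe : (fun f : Sym2 (Fin n) => if f ∈ ({e} : Finset (Sym2 (Fin n))) then (1 : unitInterval) else K f) =
          fun f => if f = s(c, d) then 1 else K f := by
        funext f; simp only [Finset.mem_singleton, he]
      have hins : insert c (insert d (∅ : Finset (Fin n))) = {c, d} := by rw [Finset.insert_empty]
      rw [hins, hG {c, d}, hGcd, hfe]
      -- the glued pair stays above `j`: `pairGlue_gain_le` (weaker endpoint gains most) and `hjcu`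
      have hgain := pairGlue_gain_le K hcd j b hle
      have hX : 0 ≤ (prodBernoulli (fun f : Sym2 (Fin n) => if f = s(c, d) then 1 else K f)).real (openConn c b) -
          (prodBernoulli (fun f : Sym2 (Fin n) => if f = s(c, d) then 1 else K f)).real (openConn j b) := by
        have t1 := mul_nonneg hu1 (sub_nonneg.2 hgain)
        nlinarith [t1, hjcu, hu0, hu1]
      have s1 := mul_nonneg hu0 hX
      have s2 := mul_le_mul_of_nonneg_left hqj hu1
      nlinarith [s1, s2, hu0, hu1]
    · -- a nonempty atom: `faceI_atom` with `s₀ ∈ Y`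
      rw [if_neg hYe]
      obtain ⟨s₀, hs₀⟩ := Finset.nonempty_iff_ne_empty.2 hYe
      have hjY : j ∉ Y := fun h => hjQ (hYQ h)
      have hatom :
        (1 - (u : ℝ)) * ((1 - (u : ℝ)) *
              ((prodBernoulli (fun e : Sym2 (Fin n) => if (∀ x ∈ e, x ∈ Y) ∧ ¬ e.IsDiag then 1 else K e)).real (openConn q b) -
                (prodBernoulli (fun e : Sym2 (Fin n) => if (∀ x ∈ e, x ∈ Y) ∧ ¬ e.IsDiag then 1 else K e)).real (openConn j b)) +
            (u : ℝ) *
              ((prodBernoulli (fun f : Sym2 (Fin n) => if f = s(c, d) then 1 else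
                  (if (∀ x ∈ f, x ∈ Y) ∧ ¬ f.IsDiag then 1 else K f))).real (openConn q b) -
                (prodBernoulli (fun f : Sym2 (Fin n) => if f = s(c, d) then 1 else
                  (if (∀ x ∈ f, x ∈ Y) ∧ ¬ f.IsDiag then 1 else K f))).real (openConn j b))) ≤
        (1 - (u : ℝ)) *
            ((prodBernoulli (fun e : Sym2 (Fin n) => if (∀ x ∈ e, x ∈ Y) ∧ ¬ e.IsDiag then 1 else K e)).real (openConn s₀ b) -
              (prodBernoulli (fun e : Sym2 (Fin n) => if (∀ x ∈ e, x ∈ Y) ∧ ¬ e.IsDiag then 1 else K e)).real (openConn j b)) +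
          (u : ℝ) *
            ((prodBernoulli (fun f : Sym2 (Fin n) => if f = s(c, s₀) then 1 else (if f = s(c, d) then 1 else
                (if (∀ x ∈ f, x ∈ Y) ∧ ¬ f.IsDiag then 1 else K f)))).real (openConn c b) -
              (prodBernoulli (fun f : Sym2 (Fin n) => if f = s(c, s₀) then 1 else (if f = s(c, d) then 1 else
                (if (∀ x ∈ f, x ∈ Y) ∧ ¬ f.IsDiag then 1 else K f)))).real (openConn j b)) := by
        obtain ⟨hRjc, hRjd⟩ := hrankI Y hY hYe
        exact faceI_atom K Y c d q j b s₀ s₀ u hs₀ hs₀ hcY hdY hbY hjY hcd hcb hdb hjb hcj hdj hRjc hRjd (hqmin s₀ (hYQ hs₀))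
      -- `G Y` through the clique of `Y`
      set C₁ : Finset (Sym2 (Fin n)) := Finset.univ.filter (fun f : Sym2 (Fin n) => (∀ x ∈ f, x ∈ Y) ∧ ¬ f.IsDiag) with hC₁
      have hreach₁ : ∀ t ∈ Y, t = s₀ ∨ s(s₀, t) ∈ C₁ ∨ ∃ m : Fin n, m ≠ s₀ ∧ m ≠ t ∧ s(m, s₀) ∈ C₁ ∧ s(m, t) ∈ C₁ := by
        intro t ht
        by_cases hts : t = s₀
        · exact Or.inl hts
        · refine Or.inr (Or.inl (Finset.mem_filter.2 ⟨Finset.mem_univ _, ?_, ?_⟩))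
          · intro x hx; rcases Sym2.mem_iff.1 hx with rfl | rfl; exact hs₀; exact ht
          · rw [Sym2.mk_isDiag_iff]; exact fun h => hts h.symm
      have hG₁ := forcedMargin_eq K o b j hisoK hbo hjo Y hoY s₀ hs₀ C₁ (cliquePairs_mem_inside Y) hreach₁
      have hf₁ := glueClique_eq_memForm K Y
      -- `G (insert c (insert d Y))` through the clique of `Y` plus the pairs `cd`, `c s₀`
      set T₂ : Finset (Fin n) := insert c (insert d Y) with hT₂
      set C₂ : Finset (Sym2 (Fin n)) := insert s(c, s₀) (insert e C₁) with hC₂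
      have hcs₀ : c ≠ s₀ := fun h => hcY (h ▸ hs₀)
      have hoT₂ : o ∉ T₂ := by
        rw [hT₂, Finset.mem_insert, Finset.mem_insert]; rintro (h | h | h); exact hoc h; exact hod h; exact hoY h
      have hcT₂ : c ∈ T₂ := Finset.mem_insert_self _ _
      have hC₂in : ∀ f ∈ C₂, ∀ x ∈ f, x ∈ T₂ := by
        intro f hf x hx
        rw [hC₂, Finset.mem_insert, Finset.mem_insert] at hf
        rcases hf with rfl | rfl | hf
        · rcases Sym2.mem_iff.1 hx with rfl | rfl
          · exact hcT₂
          · exact Finset.mem_insert_of_mem (Finset.mem_insert_of_mem hs₀)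
        · rcases Sym2.mem_iff.1 hx with rfl | rfl
          · exact hcT₂
          · exact Finset.mem_insert_of_mem (Finset.mem_insert_self _ _)
        · exact Finset.mem_insert_of_mem (Finset.mem_insert_of_mem (cliquePairs_mem_inside Y f hf x hx))
      have hreach₂ : ∀ t ∈ T₂, t = c ∨ s(c, t) ∈ C₂ ∨ ∃ m : Fin n, m ≠ c ∧ m ≠ t ∧ s(m, c) ∈ C₂ ∧ s(m, t) ∈ C₂ := by
        intro t ht
        rw [hT₂, Finset.mem_insert, Finset.mem_insert] at ht
        rcases ht with rfl | rfl | ht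
        · exact Or.inl rfl
        · exact Or.inr (Or.inl (by rw [hC₂]; exact Finset.mem_insert_of_mem (Finset.mem_insert_self _ _)))
        · by_cases hts : t = s₀
          · subst hts; exact Or.inr (Or.inl (by rw [hC₂]; exact Finset.mem_insert_self _ _))
          · refine Or.inr (Or.inr ⟨s₀, hcs₀.symm, fun h => hts h.symm, ?_, ?_⟩)
            · rw [hC₂, Sym2.eq_swap]; exact Finset.mem_insert_self _ _
            · rw [hC₂]
              refine Finset.mem_insert_of_mem (Finset.mem_insert_of_mem (Finset.mem_filter.2 ⟨Finset.mem_univ _, ?_, ?_⟩))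
              · intro x hx; rcases Sym2.mem_iff.1 hx with rfl | rfl; exact hs₀; exact ht
              · rw [Sym2.mk_isDiag_iff]; exact fun h => hts h.symm
      have hG₂ := forcedMargin_eq K o b j hisoK hbo hjo T₂ hoT₂ c hcT₂ C₂ hC₂in hreach₂
      have hecs : s(c, s₀) ≠ e := by
        rw [he]; intro h
        have : s₀ ∈ s(c, d) := h ▸ Sym2.mem_mk_right c s₀
        rcases Sym2.mem_iff.1 this with h1 | h1
        · exact hcs₀ h1.symm
        · exact hdY (h1 ▸ hs₀)
      have heC₁ : e ∉ C₁ := fun h => hcY ((Finset.mem_filter.1 h).2.1 c (by rw [he]; exact Sym2.mem_mk_left c d))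
      have hsC₁ : s(c, s₀) ∉ C₁ := fun h => hcY ((Finset.mem_filter.1 h).2.1 c (Sym2.mem_mk_left c s₀))
      have hf₂ : (fun f : Sym2 (Fin n) => if f = s(c, s₀) then (1 : unitInterval) else (if f = s(c, d) then 1 else
          (if (∀ x ∈ f, x ∈ Y) ∧ ¬ f.IsDiag then 1 else K f))) = fun f => if f ∈ C₂ then 1 else K f := by
        funext f
        rw [congrFun hf₁ f]
        by_cases h1 : f = s(c, s₀)
        · have : f ∈ C₂ := by rw [hC₂, h1]; exact Finset.mem_insert_self _ _
          rw [if_pos h1, if_pos this]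
        · rw [if_neg h1]
          by_cases h2 : f = s(c, d)
          · have : f ∈ C₂ := by rw [hC₂, h2]; exact Finset.mem_insert_of_mem (Finset.mem_insert_self _ _)
            rw [if_pos h2, if_pos this]
          · rw [if_neg h2]
            by_cases h3 : f ∈ C₁
            · have : f ∈ C₂ := by rw [hC₂]; exact Finset.mem_insert_of_mem (Finset.mem_insert_of_mem h3)
              rw [if_pos h3, if_pos this]
            · have : f ∉ C₂ := by
                rw [hC₂, Finset.mem_insert, Finset.mem_insert]
                rintro (h | h | h); exact h1 h; exact h2 (h.trans he.symm); exact h3 h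
              rw [if_neg h3, if_neg this]
      rw [hG Y, hG T₂, hG₁, hG₂, ← hf₁, ← hf₂]
      linarith [hatom]
  -- sum the atom inequality against `ν ≥ 0`
  have hsum := Finset.sum_le_sum fun Y hY => mul_le_mul_of_nonneg_left (key Y hY) (hν Y hY)
  have hlow : 0 ≤ ∑ Y ∈ Q.powerset, ν Y *
      ((1 - (u : ℝ)) * ((1 - (u : ℝ)) * ((prodBernoulli (fun f : Sym2 (Fin n) => if (∀ x ∈ f, x ∈ Y) ∧ ¬ f.IsDiag then 1 else K f)).real (openConn q b) -
            (prodBernoulli (fun f : Sym2 (Fin n) => if (∀ x ∈ f, x ∈ Y) ∧ ¬ f.IsDiag then 1 else K f)).real (openConn j b)) +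
          (u : ℝ) * ((prodBernoulli (fun f : Sym2 (Fin n) => if f = s(c, d) then 1 else
                (if (∀ x ∈ f, x ∈ Y) ∧ ¬ f.IsDiag then 1 else K f))).real (openConn q b) -
            (prodBernoulli (fun f : Sym2 (Fin n) => if f = s(c, d) then 1 else
                (if (∀ x ∈ f, x ∈ Y) ∧ ¬ f.IsDiag then 1 else K f))).real (openConn j b)))) := by
    have h2 := mul_nonneg hu1 hrowq
    rw [Finset.mul_sum] at h2
    refine le_of_le_of_eq h2 (Finset.sum_congr rfl fun Y _ => ?_)
    ring
  exact hlow.trans hsum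


/-- **The `2 + (any law)` kernel in the weakest-witness regime (I = A′)** (= `face_regimeI` + `twoPortSide_reduction`): with `c` the `K`-weaker
port of the two-port star, the witness `j` at most as connected as `c` in `K_u` and the least `b`-reliable of `c, d, j` in every mixture `K_u/Y`
(`Y ⊆ Q` nonempty), and `q` a vertex at most as connected (in `K_u`) as `j` and as every port of `Q`, the split rows of `c`, `d` and `q` give
`F ≥ 0` for EVERY law `ν ≥ 0` on the subsets of `Q`. [cite: KozmaNitzan2024, Question 9 (p. 36), Question 7 (p. 36), Lemma 5 (p. 13)] -/
theorem twoPlusLaw_regimeI (K : Sym2 (Fin n) → unitInterval) (o c d q j b : Fin n) (Q : Finset (Fin n))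
    (ν : Finset (Fin n) → ℝ) (hν : ∀ S ∈ Q.powerset, 0 ≤ ν S) (u : unitInterval) {h₁ h₂ : ℝ}
    (hh₁ : 0 < h₁) (hh₁' : h₁ ≤ 1) (hh₂ : 0 < h₂) (hh₂' : h₂ ≤ 1) (hprod : h₁ * h₂ = u) (hu1 : (u : ℝ) < 1)
    (hoQ : o ∉ Q) (hcQ : c ∉ Q) (hdQ : d ∉ Q) (hbQ : b ∉ Q) (hcd : c ≠ d) (hoc : o ≠ c) (hod : o ≠ d) (hjo : j ≠ o) (hbo : b ≠ o)
    (hisoK : ∀ u' : Fin n, u' ≠ o → K s(o, u') = 0)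
    (G : Finset (Fin n) → ℝ)
    (hG : ∀ T : Finset (Fin n), G T =
      (prodBernoulli (fun f : Sym2 (Fin n) => if f ∈ T.image (fun t => s(o, t)) then 1 else K f)).real (openConn o b) -
        (prodBernoulli (fun f : Sym2 (Fin n) => if f ∈ T.image (fun t => s(o, t)) then 1 else K f)).real (openConn j b))
    (hle : (prodBernoulli K).real (openConn c b) ≤ (prodBernoulli K).real (openConn d b))
    (hcb : c ≠ b) (hdb : d ≠ b) (hjb : j ≠ b) (hcj : c ≠ j) (hdj : d ≠ j) (hjQ : j ∉ Q)
    (hjcu : (1 - (u : ℝ)) * (prodBernoulli K).real (openConn j b) +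
        (u : ℝ) * (prodBernoulli (fun f : Sym2 (Fin n) => if f = s(c, d) then 1 else K f)).real (openConn j b) ≤
      (1 - (u : ℝ)) * (prodBernoulli K).real (openConn c b) +
        (u : ℝ) * (prodBernoulli (fun f : Sym2 (Fin n) => if f = s(c, d) then 1 else K f)).real (openConn c b))
    (hrankI : ∀ Y ∈ Q.powerset, Y ≠ ∅ →
      ((1 - (u : ℝ)) * (prodBernoulli (fun e : Sym2 (Fin n) => if (∀ x ∈ e, x ∈ Y) ∧ ¬ e.IsDiag then 1 else K e)).real (openConn j b) +
          (u : ℝ) * (prodBernoulli (fun f : Sym2 (Fin n) => if f = s(c, d) then 1 else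
            (if (∀ x ∈ f, x ∈ Y) ∧ ¬ f.IsDiag then 1 else K f))).real (openConn j b) ≤
        (1 - (u : ℝ)) * (prodBernoulli (fun e : Sym2 (Fin n) => if (∀ x ∈ e, x ∈ Y) ∧ ¬ e.IsDiag then 1 else K e)).real (openConn c b) +
          (u : ℝ) * (prodBernoulli (fun f : Sym2 (Fin n) => if f = s(c, d) then 1 else
            (if (∀ x ∈ f, x ∈ Y) ∧ ¬ f.IsDiag then 1 else K f))).real (openConn c b)) ∧
      ((1 - (u : ℝ)) * (prodBernoulli (fun e : Sym2 (Fin n) => if (∀ x ∈ e, x ∈ Y) ∧ ¬ e.IsDiag then 1 else K e)).real (openConn j b) +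
          (u : ℝ) * (prodBernoulli (fun f : Sym2 (Fin n) => if f = s(c, d) then 1 else
            (if (∀ x ∈ f, x ∈ Y) ∧ ¬ f.IsDiag then 1 else K f))).real (openConn j b) ≤
        (1 - (u : ℝ)) * (prodBernoulli (fun e : Sym2 (Fin n) => if (∀ x ∈ e, x ∈ Y) ∧ ¬ e.IsDiag then 1 else K e)).real (openConn d b) +
          (u : ℝ) * (prodBernoulli (fun f : Sym2 (Fin n) => if f = s(c, d) then 1 else
            (if (∀ x ∈ f, x ∈ Y) ∧ ¬ f.IsDiag then 1 else K f))).real (openConn d b)))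
    (hqj : (1 - (u : ℝ)) * (prodBernoulli K).real (openConn q b) +
        (u : ℝ) * (prodBernoulli (fun f : Sym2 (Fin n) => if f = s(c, d) then 1 else K f)).real (openConn q b) ≤
      (1 - (u : ℝ)) * (prodBernoulli K).real (openConn j b) +
        (u : ℝ) * (prodBernoulli (fun f : Sym2 (Fin n) => if f = s(c, d) then 1 else K f)).real (openConn j b))
    (hqmin : ∀ y ∈ Q, (1 - (u : ℝ)) * (prodBernoulli K).real (openConn q b) +
        (u : ℝ) * (prodBernoulli (fun f : Sym2 (Fin n) => if f = s(c, d) then 1 else K f)).real (openConn q b) ≤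
      (1 - (u : ℝ)) * (prodBernoulli K).real (openConn y b) +
        (u : ℝ) * (prodBernoulli (fun f : Sym2 (Fin n) => if f = s(c, d) then 1 else K f)).real (openConn y b))
    (hrowc : 0 ≤ ∑ S ∈ Q.powerset, ν S *
      ((1 - (u : ℝ)) * ((prodBernoulli (fun e : Sym2 (Fin n) => if (∀ x ∈ e, x ∈ S) ∧ ¬ e.IsDiag then 1 else K e)).real (openConn c b) -
          (prodBernoulli (fun e : Sym2 (Fin n) => if (∀ x ∈ e, x ∈ S) ∧ ¬ e.IsDiag then 1 else K e)).real (openConn j b)) +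
        (u : ℝ) * ((prodBernoulli (fun f : Sym2 (Fin n) => if f = s(c, d) then 1 else
              (if (∀ x ∈ f, x ∈ S) ∧ ¬ f.IsDiag then 1 else K f))).real (openConn c b) -
          (prodBernoulli (fun f : Sym2 (Fin n) => if f = s(c, d) then 1 else
              (if (∀ x ∈ f, x ∈ S) ∧ ¬ f.IsDiag then 1 else K f))).real (openConn j b))))
    (hrowd : 0 ≤ ∑ S ∈ Q.powerset, ν S *
      ((1 - (u : ℝ)) * ((prodBernoulli (fun e : Sym2 (Fin n) => if (∀ x ∈ e, x ∈ S) ∧ ¬ e.IsDiag then 1 else K e)).real (openConn d b) -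
          (prodBernoulli (fun e : Sym2 (Fin n) => if (∀ x ∈ e, x ∈ S) ∧ ¬ e.IsDiag then 1 else K e)).real (openConn j b)) +
        (u : ℝ) * ((prodBernoulli (fun f : Sym2 (Fin n) => if f = s(d, c) then 1 else
              (if (∀ x ∈ f, x ∈ S) ∧ ¬ f.IsDiag then 1 else K f))).real (openConn d b) -
          (prodBernoulli (fun f : Sym2 (Fin n) => if f = s(d, c) then 1 else
              (if (∀ x ∈ f, x ∈ S) ∧ ¬ f.IsDiag then 1 else K f))).real (openConn j b))))
    (hrowq : 0 ≤ ∑ S ∈ Q.powerset, ν S *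
      ((1 - (u : ℝ)) * ((prodBernoulli (fun e : Sym2 (Fin n) => if (∀ x ∈ e, x ∈ S) ∧ ¬ e.IsDiag then 1 else K e)).real (openConn q b) -
          (prodBernoulli (fun e : Sym2 (Fin n) => if (∀ x ∈ e, x ∈ S) ∧ ¬ e.IsDiag then 1 else K e)).real (openConn j b)) +
        (u : ℝ) * ((prodBernoulli (fun f : Sym2 (Fin n) => if f = s(c, d) then 1 else
              (if (∀ x ∈ f, x ∈ S) ∧ ¬ f.IsDiag then 1 else K f))).real (openConn q b) -
          (prodBernoulli (fun f : Sym2 (Fin n) => if f = s(c, d) then 1 else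
              (if (∀ x ∈ f, x ∈ S) ∧ ¬ f.IsDiag then 1 else K f))).real (openConn j b)))) :
    0 ≤ ∑ Y ∈ Q.powerset, ν Y *
        ((1 - h₁) * (1 - h₂) * (if Y = ∅ then 0 else G Y) + (1 - h₁) * h₂ * G (insert d Y) +
          h₁ * (1 - h₂) * G (insert c Y) + h₁ * h₂ * G (insert c (insert d Y))) :=
  twoPortSide_reduction K o c d j b Q ν hν u hh₁ hh₁' hh₂ hh₂' hprod hu1 hoQ hcQ hdQ hcd hoc hod hjo hbo hisoK G hG hrowc hrowd
    (face_regimeI K o c d q j b Q ν hν u hoQ hcQ hdQ hbQ hcd hoc hod hjo hbo hisoK G hG hle hcb hdb hjb hcj hdj hjQ hjcu hrankI hqj hqmin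
      hrowq)

end UpsetExchange

end

end Summit.CriticalPhenomena.PercolationContinuityZ3.Theorems
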